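import Mathlib.Topology.MetricSpace.Contracting
import Mathlib.Topology.Algebra.Module.FiniteDimension
import Mathlib.Analysis.Normed.Module.FiniteDimension
import Mathlib.LinearAlgebra.Dual.Lemmas
import Mathlib.LinearAlgebra.FiniteDimensional.Lemmas
import HarnessLib

/-!
# Newton–Kantorovich in finite dimensions from inf-sup (stability) data

Topic `Literature/Analysis/Calculus`.  The existence half of the Brezzi–Rappaz–Raviart theory of
Galerkin approximation of nonsingular solution branches (F. Brezzi, J. Rappaz, P.-A. Raviart,
*Finite dimensional approximation of nonlinear problems. Part I: branches of nonsingular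
solutions*, Numer. Math. 36 (1980) 1–25, Thm. 3; V. Girault, P.-A. Raviart, *Finite Element
Methods for Navier–Stokes Equations* (1986), Ch. IV §3, Thm. 3.1) is a Newton–Kantorovich /
simplified-Newton argument in the DISCRETE space, whose linearised operator is controlled not by
a norm bound on an inverse but by a discrete **inf-sup condition**.  This file proves that
argument once and for all in the form the applications consume, for maps with values in the
algebraic dual written as real-valued pairings (so that no normed dual has to be built):

* `Literature.Analysis.Calculus.exists_zero_of_infSup_newton` — let `T` be a finite-dimensional
  real normed space, `Φ : T → T → ℝ` ("`Φ x a = ⟨F(x), a⟩`") linear in `a`, `Λ : T → T → ℝ`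
  ("`Λ w a = ⟨DF(v) w, a⟩`") bilinear, with the centred Lipschitz/Taylor estimate
  `|Φ x a − Φ y a − Λ (x − y) a| ≤ β (‖x − v‖ + ‖y − v‖) ‖x − y‖ ‖a‖` (exact for quadratic `F`,
  `β` = norm of the quadratic part), the residual bound `|Φ v a| ≤ η ‖a‖` and the inf-sup
  condition `∀ w ∃ a, ‖w‖ ‖a‖ ≤ M Λ w a ∧ (‖w‖ > 0 → ‖a‖ > 0)` (i.e. `‖DF(v)⁻¹‖ ≤ |M|`).  If
  `8 β M² η ≤ 1` then `F` has a zero `x` (`Φ x a = 0` for all `a`) with `‖x − v‖ ≤ 2|M|η`.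
  Proof: `DF(v)` is injective by inf-sup, hence bijective onto the algebraic dual
  (`dim T* = dim T`); the simplified Newton map `g x = x − DF(v)⁻¹ F(x)` is a `½`-contraction of
  the closed ball `B̄_{2|M|η}(v)` into itself; Banach's fixed point theorem (the ball is complete,
  `T` being finite-dimensional) — verbatim the scheme of Magnus 2022, Prop. 6.7
  (`Literature/Analysis/Calculus/SimplifiedNewton.lean`), with the inverse bound supplied by the
  inf-sup constant.

No definitions, no named facts.

## Mathlib / tree search

Tree: `SimplifiedNewton.lean` (Banach-space simplified Newton with `A : E ≃L F` and Fréchet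
derivatives; here we avoid building the normed dual and the derivative).  Mathlib: Banach fixed
point (`ContractingWith.exists_fixedPoint'`), `Subspace.dual_finrank_eq`,
`LinearMap.injective_iff_surjective_of_finrank_eq_finrank`, `FiniteDimensional.complete`;
no inf-sup / Babuška–Brezzi material (searched `inf_sup`, `infSup`, `Babuska`, `Brezzi`).

## References

* F. Brezzi, J. Rappaz, P.-A. Raviart, Numer. Math. 36 (1980) 1–25, Thm. 3.
* R. Magnus, *Metric Spaces: A Companion to Analysis*, Springer (2022), §6.6, Prop. 6.7. [Magnus2022]
-/

noncomputable section

open Metric Set Filter Function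
open scoped Topology

namespace Literature.Analysis.Calculus

/-- **Newton–Kantorovich from inf-sup data (finite-dimensional, dual-free form).**  `T` a
finite-dimensional real normed space; `Φ x` linear ("`F(x) ∈ T*`"), `Λ` bilinear
("`DF(v) ∈ L(T, T*)`"); hypotheses: the centred Lipschitz estimate
`|Φ x a − Φ y a − Λ (x − y) a| ≤ β (‖x − v‖ + ‖y − v‖) ‖x − y‖ ‖a‖`, the residual `|Φ v a| ≤ η‖a‖`,
the inf-sup condition `‖w‖‖a_w‖ ≤ M Λ w a_w` with `a_w ≠ 0` for `w ≠ 0`, and the Kantorovich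
smallness `8 β M² η ≤ 1`.  Conclusion: a zero `x` of `F` with `‖x − v‖ ≤ 2 |M| η` (simplified
Newton iteration from `v`, Banach's fixed point theorem on `B̄_{2|M|η}(v)`; Magnus 2022 Prop. 6.7,
Brezzi–Rappaz–Raviart 1980 Thm. 3). [cite: Magnus2022, Prop. 6.7] -/
theorem exists_zero_of_infSup_newton {T : Type*} [NormedAddCommGroup T] [NormedSpace ℝ T]
    [FiniteDimensional ℝ T] {Φ : T → T → ℝ} {Λ : T → T → ℝ} {v : T} {β M η : ℝ}
    (hβ : 0 ≤ β) (hη : 0 ≤ η)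
    (hΦ : ∀ x, IsLinearMap ℝ (Φ x)) (hΛw : ∀ a, IsLinearMap ℝ fun w => Λ w a)
    (hΛa : ∀ w, IsLinearMap ℝ (Λ w))
    (hlip : ∀ x y a, |Φ x a - Φ y a - Λ (x - y) a| ≤ β * (‖x - v‖ + ‖y - v‖) * ‖x - y‖ * ‖a‖)
    (hres : ∀ a, |Φ v a| ≤ η * ‖a‖)
    (hinf : ∀ w, ∃ a, ‖w‖ * ‖a‖ ≤ M * Λ w a ∧ (0 < ‖w‖ → 0 < ‖a‖))
    (hsmall : 8 * β * M ^ 2 * η ≤ 1) :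
    ∃ x : T, ‖x - v‖ ≤ 2 * |M| * η ∧ ∀ a, Φ x a = 0 := by
  haveI : CompleteSpace T := FiniteDimensional.complete ℝ T
  -- ### the residual functional and the linearised operator, as linear maps
  let F : T → Module.Dual ℝ T := fun x => IsLinearMap.mk' (Φ x) (hΦ x)
  have hF : ∀ x a, F x a = Φ x a := fun x a => IsLinearMap.mk'_apply (hΦ x) a
  let A : T →ₗ[ℝ] Module.Dual ℝ T :=
    { toFun := fun w => IsLinearMap.mk' (Λ w) (hΛa w)
      map_add' := fun w₁ w₂ => by
        ext a
        simp only [IsLinearMap.mk'_apply, LinearMap.add_apply]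
        exact (hΛw a).map_add w₁ w₂
      map_smul' := fun c w => by
        ext a
        simp only [IsLinearMap.mk'_apply, LinearMap.smul_apply, RingHom.id_apply, smul_eq_mul]
        exact (hΛw a).map_smul c w }
  have hA : ∀ w a, A w a = Λ w a := fun w a => IsLinearMap.mk'_apply (hΛa w) a
  -- ### inf-sup ⇒ injective ⇒ bijective (dimension count)
  have hinj : Function.Injective A := by
    intro w₁ w₂ h
    rw [← sub_eq_zero]
    set w := w₁ - w₂ with hw
    have hAw : ∀ a, Λ w a = 0 := fun a => by
      rw [← hA, hw, map_sub, h, sub_self, LinearMap.zero_apply]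
    obtain ⟨a, h1, h2⟩ := hinf w
    by_contra hne
    have hwpos : 0 < ‖w‖ := norm_pos_iff.2 hne
    have hapos : 0 < ‖a‖ := h2 hwpos
    rw [hAw a, mul_zero] at h1
    nlinarith
  have hsurj : Function.Surjective A :=
    (LinearMap.injective_iff_surjective_of_finrank_eq_finrank
      (Subspace.dual_finrank_eq (K := ℝ) (V := T)).symm).1 hinj
  let e : T ≃ₗ[ℝ] Module.Dual ℝ T := LinearEquiv.ofBijective A ⟨hinj, hsurj⟩
  have he : ∀ w, e w = A w := fun w => LinearEquiv.ofBijective_apply A w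
  have hesymm : ∀ w, e.symm (A w) = w := fun w => by
    rw [← he, LinearEquiv.symm_apply_apply]
  -- ### the inverse bound `‖A⁻¹ φ‖ ≤ |M| t` whenever `|φ a| ≤ t ‖a‖`
  have key : ∀ (φ : Module.Dual ℝ T) (t : ℝ), 0 ≤ t → (∀ a, |φ a| ≤ t * ‖a‖) →
      ‖e.symm φ‖ ≤ |M| * t := by
    intro φ t ht hφ
    set w := e.symm φ with hw
    have hwφ : ∀ a, Λ w a = φ a := fun a => by
      rw [← hA, ← he, hw, LinearEquiv.apply_symm_apply]
    obtain ⟨a, h1, h2⟩ := hinf w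
    by_cases hw0 : ‖w‖ = 0
    · rw [hw0]; positivity
    have hwpos : 0 < ‖w‖ := lt_of_le_of_ne (norm_nonneg _) (Ne.symm hw0)
    have hapos : 0 < ‖a‖ := h2 hwpos
    have h3 : ‖w‖ * ‖a‖ ≤ |M| * t * ‖a‖ := by
      calc ‖w‖ * ‖a‖ ≤ M * Λ w a := h1
        _ ≤ |M * Λ w a| := le_abs_self _
        _ = |M| * |φ a| := by rw [abs_mul, hwφ]
        _ ≤ |M| * (t * ‖a‖) := mul_le_mul_of_nonneg_left (hφ a) (abs_nonneg _)
        _ = |M| * t * ‖a‖ := by ring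
    exact le_of_mul_le_mul_right h3 hapos
  -- ### the simplified Newton map
  let g : T → T := fun x => x - e.symm (F x)
  have hgsub : ∀ x y, g x - g y = e.symm (A (x - y) - (F x - F y)) := by
    intro x y
    simp only [g, map_sub, hesymm]
    abel
  have hglip : ∀ x y, ‖g x - g y‖ ≤ |M| * (β * (‖x - v‖ + ‖y - v‖) * ‖x - y‖) := by
    intro x y
    rw [hgsub]
    refine key _ _ (by positivity) fun a => ?_
    rw [LinearMap.sub_apply, LinearMap.sub_apply, hA, hF, hF]
    calc |Λ (x - y) a - (Φ x a - Φ y a)| = |Φ x a - Φ y a - Λ (x - y) a| := abs_sub_comm _ _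
      _ ≤ β * (‖x - v‖ + ‖y - v‖) * ‖x - y‖ * ‖a‖ := hlip x y a
  have hgv : ‖g v - v‖ ≤ |M| * η := by
    have : g v - v = -e.symm (F v) := by simp only [g]; abel
    rw [this, norm_neg]
    exact key _ _ hη fun a => by rw [hF]; exact hres a
  -- ### the ball `B̄_r(v)`, `r = 2|M|η`: `g` is a `½`-contraction of it into itself
  set r : ℝ := 2 * |M| * η with hr
  have hr0 : 0 ≤ r := by positivity
  set k : ℝ := 4 * β * M ^ 2 * η with hk
  have hk0 : 0 ≤ k := by positivity
  have hk1 : k ≤ 1 / 2 := by linarith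
  have hlip_ball : ∀ x ∈ closedBall v r, ∀ y ∈ closedBall v r, ‖g x - g y‖ ≤ k * ‖x - y‖ := by
    intro x hx y hy
    rw [mem_closedBall_iff_norm] at hx hy
    calc ‖g x - g y‖ ≤ |M| * (β * (‖x - v‖ + ‖y - v‖) * ‖x - y‖) := hglip x y
      _ ≤ |M| * (β * (r + r) * ‖x - y‖) := by gcongr
      _ = k * ‖x - y‖ := by rw [hk, hr, ← sq_abs M]; ring
  have hmaps : MapsTo g (closedBall v r) (closedBall v r) := by
    intro x hx
    have hxr : ‖x - v‖ ≤ r := mem_closedBall_iff_norm.1 hx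
    rw [mem_closedBall_iff_norm]
    calc ‖g x - v‖ = ‖(g x - g v) + (g v - v)‖ := by abel_nf
      _ ≤ ‖g x - g v‖ + ‖g v - v‖ := norm_add_le _ _
      _ ≤ k * ‖x - v‖ + |M| * η := add_le_add (hlip_ball x hx v (mem_closedBall_self hr0)) hgv
      _ ≤ (1 / 2) * r + |M| * η := by gcongr
      _ = r := by rw [hr]; ring
  -- ### Banach's fixed point theorem on the complete subset `closedBall v r`
  obtain ⟨K, hK⟩ : ∃ K : NNReal, (K : ℝ) = k := ⟨⟨k, hk0⟩, rfl⟩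
  have hK₁ : K < 1 := by
    rw [← NNReal.coe_lt_coe, hK, NNReal.coe_one]
    linarith
  have hlipK : LipschitzOnWith K g (closedBall v r) := by
    refine LipschitzOnWith.of_dist_le_mul fun x hx y hy => ?_
    rw [dist_eq_norm, dist_eq_norm, hK]
    exact hlip_ball x hx y hy
  have hc : ContractingWith K (hmaps.restrict g _ _) := ⟨hK₁, hlipK.mapsToRestrict hmaps⟩
  obtain ⟨x, hx, hfix, -, -⟩ :=
    hc.exists_fixedPoint' isClosed_closedBall.isComplete hmaps (mem_closedBall_self hr0)
      (edist_ne_top _ _)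
  refine ⟨x, mem_closedBall_iff_norm.1 hx, fun a => ?_⟩
  have h0 : e.symm (F x) = 0 := by
    have h := hfix
    rw [IsFixedPt] at h
    simpa only [g, sub_eq_self] using h
  have hFx : F x = 0 := (LinearEquiv.map_eq_zero_iff e.symm).1 h0
  rw [← hF, hFx, LinearMap.zero_apply]

end Literature.Analysis.Calculus

end
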